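import Literature.NumberTheory.EllipticCurves.QuadraticTwistTateFormTwoProofs
import Literature.NumberTheory.EllipticCurves.QuadraticTwistMinimalModelProofs
import Literature.NumberTheory.EllipticCurves.MultiplicativeReductionJValuationProofs
import Literature.NumberTheory.EllipticCurves.SzpiroLocalDataProofs
import Literature.NumberTheory.DiophantineGeometry.ConductorRingOfIntegersProofs
import Literature.NumberTheory.DiophantineGeometry.ConductorMultiplicativeProofs
import Literature.NumberTheory.DiophantineGeometry.ConductorFactorizationProofs
import Literature.NumberTheory.DiophantineGeometry.MinimalDiscriminantRingOfIntegersProofs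
import Mathlib.Analysis.SpecialFunctions.Log.Basic
import HarnessLib

/-!
# Crux `SingleTowerSzpiro` (stmt-ABC-22410), line `birth` — stub `stub_twistTransferTwo`

TWIST TRANSFER AT THE PLACE `2` (registered stub `stub_twistTransferTwo` of
`Cruxes/SingleTowerSzpiro/Lines/birth.lean`, rev 3): the multiplicative-tower statement S1
(`∀ ε > 0 ∃ C ∀ E' ∀ v, f_v(E') = 1 → ord_v Δ_min(E') · log p_v ≤ (6+ε) log N_{E'} + C`) implies the
single-tower bound at the place `2` for every elliptic `E/ℚ` with `ord₂(j_E) < 0` and `f₂(E) ≠ 1`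
(additive, potentially multiplicative reduction at `2`), with the SAME constant.

Proof (every input is a PROVED tree theorem). Let `T = tateFormOfJ j_E` (`y² + xy = x³ − 36x/(j−1728) −
1/(j−1728)`), so `E ≅ T^{(d)}` over `ℚ` with `d ∈ ℤ`, `4 ∤ d`
(`WeierstrassCurve.exists_int_variableChange_eq_quadraticTwist_tateFormOfJ`). Write `ord₂(j_E) = −ν`.
* `d ≡ 1 (mod 4)` is excluded: then `E` is multiplicative at `2`
  (`WeierstrassCurve.hasMultiplicativeReductionAt_of_emod_four_eq_one`), i.e. `f₂ = 1`.
* `d ≡ 3 (mod 4)`: `f₂(E) = 4`, `ord₂ Δ_min(E) = ν + 12`; `d ≡ 2 (mod 4)`: `f₂(E) = 6`, `ord₂ Δ_min(E) = ν + 18`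
  (`WeierstrassCurve.conductorExponent_eq_four_of_emod_four_eq_three`, `…_eq_six_of_emod_four_eq_two`,
  `WeierstrassCurve.kodairaSymbolAt_and_ordMinimalDiscriminant_of_emod_four_eq_three/two` — Tate's algorithm
  at `2`, Kraus 1989; stated in the tree at the place of `𝓞 ℚ` above `2` and transported to the place of `ℤ`
  by `conductorExponent_eq_of_primesEquiv_eq`, `ordMinimalDiscriminant_eq_padic`, `valuation_equiv_padicValuation`).
* PARTNER: `d = d'·t` with `d' ≡ 1 (mod 4)` and `t ∈ {−1, 2, −2}` (`d' = −d`, resp. `±d/2`); `E' := T^{(d')}` is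
  multiplicative at `2` with `j(E') = j(E)`, so `f₂(E') = 1` and `ord₂ Δ_min(E') = ν`
  (`WeierstrassCurve.valuation_j_eq_exp_ordMinimalDiscriminant_of_hasMultiplicativeReductionAt`), and
  `E ≅ E'^{(t)}` (`quadraticTwist_quadraticTwist`). The twist by `t = 4k + 1` is unramified at every ODD
  place `q` (`|k|_q ≤ 1`, `|t|_q = 1`), so `f_q(E) = f_q(E')` there
  (`WeierstrassCurve.exists_variableChange_twistModel_eq_quadraticTwist`, `conductorExponent_twistModel`,
  `conductorExponent_smul'`), whence `N_E · 2 = N_{E'} · 2^{f₂(E)}` (`factorization_conductorNorm_holds`).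
* TRANSFER (place-independent bookkeeping, `tower_le_of_partner`): from S1 at `(E', 2)`,
  `ord₂ Δ_min(E) ≤ ord₂ Δ_min(E') + 6 (f₂(E) − 1)` and `log N_{E'} = log N_E − (f₂(E) − 1) log 2`:
  `tower₂(E) ≤ (6+ε) log N_E + C − ε (f₂(E) − 1) log 2 ≤ (6+ε) log N_E + C`.

HONESTY: classical bookkeeping of the line (Comalada 1994; Silverman ATAEC IV.9–IV.11), NOT progress on the
crux `SingleTowerSzpiro` (all difficulty sits in `stub_multiplicativeTower`, the hypothesis here); abc is
not proved by any of this; A-PS / A1′ are NOT abc; typed ≠ proved. No `sorry`, no new axiom, no `def`.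

References: J. H. Silverman, *Advanced Topics in the Arithmetic of Elliptic Curves*, GTM 151 (1994), IV.9.4,
Table 4.1, IV.10–IV.11; S. Comalada, *Twists and reduction of an elliptic curve*, J. Number Theory 49 (1994),
45–62; A. Kraus, Acta Arith. 54 (1989), Prop. 2.
-/

noncomputable section

-- `Summit.<Summit>.<Problem>` is the mandated summit-side namespace (CONVENTIONS §2); for the
-- single-conjunct summit `ABC` the two coincide, so the duplicate `ABC.ABC` is deliberate.
set_option linter.dupNamespace false

namespace Summit.ABC.ABC.Theorems.SingleTowerSzpiroLine

open scoped NumberField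
open IsDedekindDomain Rat.HeightOneSpectrum Literature.NumberTheory.EllipticCurves

/-! ## Valuations of small integers at the places of `ℤ` -/

/-- At an odd place `v` of `ℤ`, `|2|_v = 1` (`Literature.NumberTheory.EllipticCurves.Rat.valuation_intCast_eq_one_iff`).
[folklore] -/
theorem int_valuation_two_eq_one (v : HeightOneSpectrum ℤ) (hv : natGenerator v ≠ 2) :
    v.valuation ℚ (2 : ℚ) = 1 := by
  have h : v.valuation ℚ ((2 : ℤ) : ℚ) = 1 := by
    rw [Rat.valuation_intCast_eq_one_iff]
    intro h
    have h' : natGenerator v ∣ 2 := by exact_mod_cast h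
    rcases (Nat.dvd_prime Nat.prime_two).mp h' with h1 | h2
    · exact (prime_natGenerator v).one_lt.ne' h1
    · exact hv h2
  exact_mod_cast h

/-! ## Transport between the places of `ℤ` and of `𝓞 ℚ` above the same prime -/

/-- `ord_v(x) < 0` is the same condition at the places of `ℤ` and of `𝓞 ℚ` above one prime: both
valuations are equivalent to the `p`-adic valuation (`Rat.HeightOneSpectrum.valuation_equiv_padicValuation`).
[folklore] -/
theorem one_lt_valuation_iff_of_natGenerator_eq (v : HeightOneSpectrum ℤ) (v' : HeightOneSpectrum (𝓞 ℚ))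
    (h : natGenerator v = natGenerator v') (x : ℚ) :
    1 < v.valuation ℚ x ↔ 1 < v'.valuation ℚ x := by
  have hvv' : primesEquiv v = primesEquiv v' := Subtype.ext h
  have h1 := valuation_equiv_padicValuation v
  have h2 := valuation_equiv_padicValuation v'
  rw [hvv'] at h1
  exact (h1.trans h2.symm).one_lt_iff_one_lt

/-- `ord_v Δ_min` agrees at the places of `ℤ` and of `𝓞 ℚ` above one prime (both are computed in `ℚ_p`,
`WeierstrassCurve.ordMinimalDiscriminant_eq_padic`). [folklore] -/
theorem ordMinimalDiscriminant_eq_of_natGenerator_eq (W : WeierstrassCurve ℚ) (v : HeightOneSpectrum ℤ)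
    (v' : HeightOneSpectrum (𝓞 ℚ)) (h : natGenerator v = natGenerator v') :
    W.ordMinimalDiscriminant v = W.ordMinimalDiscriminant v' := by
  have hvv' : primesEquiv v = primesEquiv v' := Subtype.ext h
  let e : Nat.Primes → ℕ := fun p =>
    haveI : Fact p.1.Prime := ⟨p.2⟩
    (IsDiscreteValuationRing.addVal ℤ_[p]
      (((W.baseChange ℚ_[p]).minimal ℤ_[p]).integralModel ℤ_[p]).Δ).toNat
  have h1 : W.ordMinimalDiscriminant v = e (primesEquiv v) := W.ordMinimalDiscriminant_eq_padic v
  have h2 : W.ordMinimalDiscriminant v' = e (primesEquiv v') := W.ordMinimalDiscriminant_eq_padic v'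
  rw [h1, h2, hvv']

/-! ## The conductor away from `2` under a twist ramified only at `2` -/

/-- **An odd place does not see the twist by `−1`, `2` or `−2`.** If `C • W = E^{(t)}` over `ℚ` with
`t ∈ {−1, 2, −2}`, then `f_q(W) = f_q(E)` at every place `q ≠ 2` of `ℤ`: `E^{(t)}` is `ℚ`-isomorphic to the
integral twist model `E.twistModel k`, `t = 4k + 1` (`exists_variableChange_twistModel_eq_quadraticTwist`),
`|k|_q ≤ 1` and `|t|_q = 1`, so `conductorExponent_twistModel` (twist unramified at `q`; Comalada 1994 §2)
and the isomorphism invariance `conductorExponent_smul'` apply. [folklore] -/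
theorem conductorExponent_eq_of_twist_two {W E : WeierstrassCurve ℚ} [W.IsElliptic] [E.IsElliptic]
    {t : ℚ} (ht : t = -1 ∨ t = 2 ∨ t = -2) {C : WeierstrassCurve.VariableChange ℚ}
    (hC : C • W = E.quadraticTwist t) (v : HeightOneSpectrum ℤ) (hv : natGenerator v ≠ 2) :
    W.conductorExponent v = E.conductorExponent v := by
  set k : ℚ := (t - 1) / 4 with hk
  have htk : 4 * k + 1 = t := by rw [hk]; ring
  obtain ⟨C₁, -, hC₁⟩ := E.exists_variableChange_twistModel_eq_quadraticTwist k
  rw [htk] at hC₁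
  have hE' : E.twistModel k = (C⁻¹ * C₁)⁻¹ • W := by
    rw [mul_inv_rev, inv_inv, mul_smul, hC, ← hC₁, inv_smul_smul]
  have h2 : v.valuation ℚ (2 : ℚ) = 1 := int_valuation_two_eq_one v hv
  have h4 : v.valuation ℚ (4 : ℚ) = 1 := by
    rw [show (4 : ℚ) = 2 * 2 by norm_num, map_mul, h2, mul_one]
  have hvt : v.valuation ℚ t = 1 := by
    rcases ht with rfl | rfl | rfl
    · rw [Valuation.map_neg, map_one]
    · exact h2
    · rw [Valuation.map_neg, h2]
  have hint : ∀ n : ℤ, v.valuation ℚ (n : ℚ) ≤ 1 := fun n => by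
    rw [show (n : ℚ) = algebraMap ℤ ℚ n from (eq_intCast _ n).symm]
    exact HeightOneSpectrum.valuation_le_one v n
  have hvk : v.valuation ℚ k ≤ 1 := by
    rw [hk, map_div₀, h4, div_one]
    rcases ht with rfl | rfl | rfl
    · rw [show (-1 - 1 : ℚ) = ((-2 : ℤ) : ℚ) by norm_num]; exact hint _
    · rw [show (2 - 1 : ℚ) = ((1 : ℤ) : ℚ) by norm_num]; exact hint _
    · rw [show (-2 - 1 : ℚ) = ((-3 : ℤ) : ℚ) by norm_num]; exact hint _
  have hvd : v.valuation ℚ (4 * k + 1) = 1 := by rw [htk]; exact hvt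
  calc W.conductorExponent v
      = (((C⁻¹ * C₁)⁻¹) • W).conductorExponent v :=
        (WeierstrassCurve.conductorExponent_smul' v W _).symm
    _ = (E.twistModel k).conductorExponent v := by rw [← hE']
    _ = E.conductorExponent v := WeierstrassCurve.conductorExponent_twistModel v E hvk hvd

/-- **Conductor norms of two curves with the same exponents away from `2`**:
`N_W · 2^{f₂(E)} = N_E · 2^{f₂(W)}` (`N = ∏_p p^{f_p}`, `WeierstrassCurve.factorization_conductorNorm_holds`).
[folklore] -/
theorem conductorNorm_mul_pow_eq (W E : WeierstrassCurve ℚ) [W.IsElliptic] [E.IsElliptic]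
    (v₂ : HeightOneSpectrum ℤ) (hv₂ : natGenerator v₂ = 2)
    (hodd : ∀ v : HeightOneSpectrum ℤ, natGenerator v ≠ 2 → W.conductorExponent v = E.conductorExponent v) :
    W.conductorNorm ℤ * 2 ^ E.conductorExponent v₂ = E.conductorNorm ℤ * 2 ^ W.conductorExponent v₂ := by
  have hW : W.conductorNorm ℤ ≠ 0 := (WeierstrassCurve.conductorNorm_pos_holds W).ne'
  have hE : E.conductorNorm ℤ ≠ 0 := (WeierstrassCurve.conductorNorm_pos_holds E).ne'
  apply Nat.eq_of_factorization_eq (mul_ne_zero hW (pow_ne_zero _ two_ne_zero))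
    (mul_ne_zero hE (pow_ne_zero _ two_ne_zero))
  intro p
  rw [Nat.factorization_mul hW (pow_ne_zero _ two_ne_zero),
    Nat.factorization_mul hE (pow_ne_zero _ two_ne_zero), Nat.factorization_pow, Nat.factorization_pow]
  simp only [Finsupp.coe_add, Finsupp.coe_smul, Pi.add_apply, Pi.smul_apply, smul_eq_mul]
  by_cases hp : p.Prime
  swap
  · simp [Nat.factorization_eq_zero_of_not_prime _ hp]
  rw [Nat.Prime.factorization Nat.prime_two, Finsupp.single_apply]
  set v : HeightOneSpectrum ℤ := (primesEquiv (R := ℤ)).symm ⟨p, hp⟩ with hvdef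
  have hv : natGenerator v = p :=
    congrArg Subtype.val ((primesEquiv (R := ℤ)).apply_symm_apply ⟨p, hp⟩)
  have hfW : (W.conductorNorm ℤ).factorization p = W.conductorExponent v := by
    rw [← hv]; exact WeierstrassCurve.factorization_conductorNorm_holds W v
  have hfE : (E.conductorNorm ℤ).factorization p = E.conductorExponent v := by
    rw [← hv]; exact WeierstrassCurve.factorization_conductorNorm_holds E v
  rw [hfW, hfE]
  by_cases h2p : (2 : ℕ) = p
  · have hvv : v = v₂ :=
      (primesEquiv (R := ℤ)).injective (Subtype.ext (hv.trans (h2p.symm.trans hv₂.symm)))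
    rw [if_pos h2p, hvv]
    ring
  · rw [if_neg h2p, mul_zero, mul_zero, add_zero, add_zero]
    exact hodd v (by rw [hv]; exact fun h => h2p h.symm)

/-! ## The place-independent transfer step -/

/-- **Transfer of the multiplicative-tower bound to a partner.** Let `v₂` be the place of `ℤ` above `2`,
`W`, `E` elliptic with the same conductor exponents away from `2`, `f₂(E) = 1`, `f₂(W) ≥ 1` and
`ord₂ Δ_min(W) ≤ ord₂ Δ_min(E) + 6 (f₂(W) − 1)`. If the tower of `E` at `2` obeys
`ord₂ Δ_min(E) log 2 ≤ (6+ε) log N_E + C`, then so does the tower of `W` with `N_W`: indeed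
`N_W · 2 = N_E · 2^{f₂(W)}` (`conductorNorm_mul_pow_eq`), so `log N_E = log N_W − (f₂(W) − 1) log 2` and the
`6 (f − 1) log 2` gained is paid by `(6+ε)(f − 1) log 2`. [folklore] -/
theorem tower_le_of_partner {ε C₁ : ℝ} (hε : 0 < ε) (W E : WeierstrassCurve ℚ) [W.IsElliptic]
    [E.IsElliptic] (v₂ : HeightOneSpectrum ℤ) (hv₂ : natGenerator v₂ = 2)
    (hodd : ∀ v : HeightOneSpectrum ℤ, natGenerator v ≠ 2 → W.conductorExponent v = E.conductorExponent v)
    (hfE : E.conductorExponent v₂ = 1) (hfW : 1 ≤ W.conductorExponent v₂)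
    (hord : W.ordMinimalDiscriminant v₂ + 6 ≤ E.ordMinimalDiscriminant v₂ + 6 * W.conductorExponent v₂)
    (hS1 : (E.ordMinimalDiscriminant v₂ : ℝ) * Real.log (natGenerator v₂ : ℝ) ≤
      (6 + ε) * Real.log (E.conductorNorm ℤ : ℝ) + C₁) :
    (W.ordMinimalDiscriminant v₂ : ℝ) * Real.log (natGenerator v₂ : ℝ) ≤
      (6 + ε) * Real.log (W.conductorNorm ℤ : ℝ) + C₁ := by
  have hN := conductorNorm_mul_pow_eq W E v₂ hv₂ hodd
  rw [hfE, pow_one] at hN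
  have hWpos : (0 : ℝ) < (W.conductorNorm ℤ : ℝ) := by
    exact_mod_cast WeierstrassCurve.conductorNorm_pos_holds W
  have hEpos : (0 : ℝ) < (E.conductorNorm ℤ : ℝ) := by
    exact_mod_cast WeierstrassCurve.conductorNorm_pos_holds E
  set f : ℕ := W.conductorExponent v₂ with hfdef
  set A : ℝ := Real.log (W.conductorNorm ℤ : ℝ) with hAdef
  set L : ℝ := Real.log 2 with hLdef
  have hlog : Real.log (E.conductorNorm ℤ : ℝ) = A + L - (f : ℝ) * L := by
    have h : (W.conductorNorm ℤ : ℝ) * 2 = (E.conductorNorm ℤ : ℝ) * 2 ^ f := by exact_mod_cast hN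
    have h' := congrArg Real.log h
    rw [Real.log_mul hWpos.ne' two_ne_zero, Real.log_mul hEpos.ne' (pow_ne_zero _ two_ne_zero),
      Real.log_pow] at h'
    rw [hAdef, hLdef]
    linarith
  rw [hv₂, Nat.cast_ofNat] at hS1 ⊢
  rw [hlog] at hS1
  have hL : 0 < L := Real.log_pos one_lt_two
  have hf1 : (1 : ℝ) ≤ (f : ℝ) := by exact_mod_cast hfW
  have hordR : (W.ordMinimalDiscriminant v₂ : ℝ) + 6 ≤ (E.ordMinimalDiscriminant v₂ : ℝ) + 6 * (f : ℝ) := by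
    exact_mod_cast hord
  have h1 : (W.ordMinimalDiscriminant v₂ : ℝ) * L ≤
      (E.ordMinimalDiscriminant v₂ : ℝ) * L + 6 * (f : ℝ) * L - 6 * L := by
    nlinarith [hordR, hL]
  have hprod : 0 ≤ ε * ((f : ℝ) - 1) * L := by
    have : 0 ≤ (f : ℝ) - 1 := by linarith
    positivity
  have key : (6 + ε) * (A + L - (f : ℝ) * L) + C₁ + 6 * (f : ℝ) * L - 6 * L =
      (6 + ε) * A + C₁ - ε * ((f : ℝ) - 1) * L := by ring
  calc (W.ordMinimalDiscriminant v₂ : ℝ) * L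
      ≤ (E.ordMinimalDiscriminant v₂ : ℝ) * L + 6 * (f : ℝ) * L - 6 * L := h1
    _ ≤ (6 + ε) * (A + L - (f : ℝ) * L) + C₁ + 6 * (f : ℝ) * L - 6 * L := by linarith [hS1]
    _ = (6 + ε) * A + C₁ - ε * ((f : ℝ) - 1) * L := key
    _ ≤ (6 + ε) * A + C₁ := by linarith [hprod]

/-! ## The partner at `2` and the stub -/

/-- **The partner curve.** For `W/ℚ` with `ord₂(j) = −ν < 0` and `C • W = T^{(d)}`, `T = tateFormOfJ j(W)`,
`d = d'·t` with `d' ≡ 1 (mod 4)`, `t ∈ {−1, 2, −2}`: the curve `E' = T^{(d')}` has `f₂(E') = 1`,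
`ord₂ Δ_min(E') = ν` and the same conductor exponents as `W` away from `2`; hence, given the
multiplicative-tower bound for `E'` at `2` and `ord₂ Δ_min(W) ≤ ν + 6 (f₂(W) − 1)`, the tower of `W` at `2`
obeys the same bound (`tower_le_of_partner`). Silverman ATAEC IV.9–11; Comalada 1994. [folklore] -/
theorem tower_two_le_of_tateForm_twist {ε C₁ : ℝ} (hε : 0 < ε)
    (hS1 : ∀ (E : WeierstrassCurve ℚ) [E.IsElliptic] (v : HeightOneSpectrum ℤ),
      E.conductorExponent v = 1 →
        (E.ordMinimalDiscriminant v : ℝ) * Real.log (natGenerator v : ℝ) ≤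
          (6 + ε) * Real.log (E.conductorNorm ℤ : ℝ) + C₁)
    (W : WeierstrassCurve ℚ) [W.IsElliptic] (v : HeightOneSpectrum ℤ) (hv : natGenerator v = 2)
    (v' : HeightOneSpectrum (𝓞 ℚ)) (hv' : natGenerator v' = 2)
    (hj' : 1 < v'.valuation ℚ W.j) {ν : ℕ} (hν : v'.valuation ℚ W.j = WithZero.exp (ν : ℤ))
    {d d' : ℤ} {t : ℚ} (hd' : d' % 4 = 1) (ht : t = -1 ∨ t = 2 ∨ t = -2)
    (hdt : (d : ℚ) = (d' : ℚ) * t) {C : WeierstrassCurve.VariableChange ℚ}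
    (hC : C • W = (tateFormOfJ W.j).quadraticTwist (d : ℚ))
    (hfW : 1 ≤ W.conductorExponent v)
    (hordW : W.ordMinimalDiscriminant v + 6 ≤ ν + 6 * W.conductorExponent v) :
    (W.ordMinimalDiscriminant v : ℝ) * Real.log (natGenerator v : ℝ) ≤
      (6 + ε) * Real.log (W.conductorNorm ℤ : ℝ) + C₁ := by
  have hgen : natGenerator v = natGenerator v' := hv.trans hv'.symm
  have hvv' : primesEquiv v = primesEquiv v' := Subtype.ext hgen
  obtain ⟨hj0, hj1728, -⟩ := W.j_ne_and_valuation_j_sub_eq_of_one_lt_valuation_j v' hj'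
  haveI hT := isElliptic_tateFormOfJ hj0 hj1728
  have hTj : (tateFormOfJ W.j).j = W.j := tateFormOfJ_j hj0 hj1728
  have hd'0 : (d' : ℚ) ≠ 0 := by
    have : d' ≠ 0 := by rintro rfl; simp at hd'
    exact_mod_cast this
  haveI hE : ((tateFormOfJ W.j).quadraticTwist (d' : ℚ)).IsElliptic :=
    WeierstrassCurve.isElliptic_quadraticTwist _ hd'0
  have hEj : ((tateFormOfJ W.j).quadraticTwist (d' : ℚ)).j = W.j := by
    rw [WeierstrassCurve.j_quadraticTwist _ hd'0, hTj]
  -- the partner is multiplicative at `2`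
  have hjE : 1 < v'.valuation ℚ ((tateFormOfJ W.j).quadraticTwist (d' : ℚ)).j := by rw [hEj]; exact hj'
  have hE1 : (1 : WeierstrassCurve.VariableChange ℚ) • (tateFormOfJ W.j).quadraticTwist (d' : ℚ) =
      (tateFormOfJ ((tateFormOfJ W.j).quadraticTwist (d' : ℚ)).j).quadraticTwist (d' : ℚ) := by
    rw [one_smul, hEj]
  have hmult := WeierstrassCurve.hasMultiplicativeReductionAt_of_emod_four_eq_one v' hv'
    ((tateFormOfJ W.j).quadraticTwist (d' : ℚ)) hjE hd' hE1
  have hfE' : ((tateFormOfJ W.j).quadraticTwist (d' : ℚ)).conductorExponent v' = 1 :=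
    (WeierstrassCurve.conductorExponent_eq_one_iff_holds v' _).mpr hmult
  have hfE : ((tateFormOfJ W.j).quadraticTwist (d' : ℚ)).conductorExponent v = 1 := by
    rw [WeierstrassCurve.conductorExponent_eq_of_primesEquiv_eq v v' _ hvv']; exact hfE'
  -- `ord₂ Δ_min(E') = ν`
  have hordE' : ((tateFormOfJ W.j).quadraticTwist (d' : ℚ)).ordMinimalDiscriminant v' = ν := by
    have h := WeierstrassCurve.valuation_j_eq_exp_ordMinimalDiscriminant_of_hasMultiplicativeReductionAt
      v' _ hmult
    rw [hEj, hν] at h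
    have := WithZero.exp_injective h
    omega
  have hordE : ((tateFormOfJ W.j).quadraticTwist (d' : ℚ)).ordMinimalDiscriminant v = ν := by
    rw [ordMinimalDiscriminant_eq_of_natGenerator_eq _ v v' hgen]; exact hordE'
  -- `W ≅ E'^{(t)}`: same exponents away from `2`
  have hCW : C • W = ((tateFormOfJ W.j).quadraticTwist (d' : ℚ)).quadraticTwist t := by
    rw [hC, hdt, WeierstrassCurve.quadraticTwist_quadraticTwist]
  have hodd : ∀ w : HeightOneSpectrum ℤ, natGenerator w ≠ 2 →
      W.conductorExponent w = ((tateFormOfJ W.j).quadraticTwist (d' : ℚ)).conductorExponent w :=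
    fun w hw => conductorExponent_eq_of_twist_two ht hCW w hw
  -- S1 for the partner at `2`, then transfer
  have hS1E := hS1 ((tateFormOfJ W.j).quadraticTwist (d' : ℚ)) v hfE
  rw [hordE] at hS1E
  refine tower_le_of_partner hε W ((tateFormOfJ W.j).quadraticTwist (d' : ℚ)) v hv hodd hfE hfW ?_ ?_
  · rw [hordE]; exact hordW
  · rw [hordE]; exact hS1E

/-- **Stub `stub_twistTransferTwo` of line `birth` (crux stmt-ABC-22410).** The multiplicative-tower
statement implies the single-tower bound, with the same constant, at the place `2` for every elliptic
`E/ℚ` with `f₂(E) ≠ 1` and `ord₂(j_E) < 0` (additive, potentially multiplicative reduction at `2`): `E` is a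
quadratic twist, ramified at `2` only up to an unramified-at-`2` factor, of a curve `E'` multiplicative at `2`
with `f₂(E) ∈ {4, 6}`, `ord₂ Δ_min(E) = ord₂ Δ_min(E') + 3 f₂(E)`, `N_E = 2^{f₂(E) − 1} N_{E'}`, and
`3f ≤ 6(f − 1)`. Silverman ATAEC IV.9.4 / IV.11; Comalada 1994; Kraus 1989 Prop. 2. [folklore] -/
theorem stub_twistTransferTwo : (∀ ε : ℝ, 0 < ε → ∃ C : ℝ, ∀ (W : WeierstrassCurve ℚ) [W.IsElliptic] (v : HeightOneSpectrum ℤ), W.conductorExponent v = 1 → (W.ordMinimalDiscriminant v : ℝ) * Real.log (Rat.HeightOneSpectrum.natGenerator v : ℝ) ≤ (6 + ε) * Real.log (W.conductorNorm ℤ : ℝ) + C) → ∀ ε : ℝ, 0 < ε → ∃ C : ℝ, ∀ (W : WeierstrassCurve ℚ) [W.IsElliptic] (v : HeightOneSpectrum ℤ), Rat.HeightOneSpectrum.natGenerator v = 2 → W.conductorExponent v ≠ 1 → 1 < v.valuation ℚ W.j → (W.ordMinimalDiscriminant v : ℝ) * Real.log (Rat.HeightOneSpectrum.natGenerator v : ℝ)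 ≤ (6 + ε) * Real.log (W.conductorNorm ℤ : ℝ) + C := by
  intro hS1 ε hε
  obtain ⟨C₁, hC₁⟩ := hS1 ε hε
  refine ⟨C₁, fun W _ v hv hf hj => ?_⟩
  -- the place of `𝓞 ℚ` above `2`
  set v' : HeightOneSpectrum (𝓞 ℚ) := (primesEquiv (R := 𝓞 ℚ)).symm ⟨2, Nat.prime_two⟩ with hv'def
  have hv' : natGenerator v' = 2 :=
    congrArg Subtype.val ((primesEquiv (R := 𝓞 ℚ)).apply_symm_apply ⟨2, Nat.prime_two⟩)
  have hgen : natGenerator v = natGenerator v' := hv.trans hv'.symm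
  have hj' : 1 < v'.valuation ℚ W.j := (one_lt_valuation_iff_of_natGenerator_eq v v' hgen W.j).mp hj
  have hfvv' : W.conductorExponent v = W.conductorExponent v' :=
    WeierstrassCurve.conductorExponent_eq_of_primesEquiv_eq v v' W (Subtype.ext hgen)
  have hordvv' : W.ordMinimalDiscriminant v = W.ordMinimalDiscriminant v' :=
    ordMinimalDiscriminant_eq_of_natGenerator_eq W v v' hgen
  obtain ⟨hj0, hj1728, -⟩ := W.j_ne_and_valuation_j_sub_eq_of_one_lt_valuation_j v' hj'
  obtain ⟨ν, -, hν⟩ := WeierstrassCurve.exists_valuation_j_eq_exp v' W hj'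
  obtain ⟨d, -, hd4, C, hC⟩ := W.exists_int_variableChange_eq_quadraticTwist_tateFormOfJ hj0 hj1728
  have hcases : d % 4 = 1 ∨ d % 4 = 3 ∨ d % 4 = 2 := by omega
  rcases hcases with h1 | h3 | h2
  · -- `d ≡ 1 (mod 4)`: multiplicative at `2`, excluded
    exfalso
    have hmult := WeierstrassCurve.hasMultiplicativeReductionAt_of_emod_four_eq_one v' hv' W hj' h1 hC
    exact hf (hfvv'.trans ((WeierstrassCurve.conductorExponent_eq_one_iff_holds v' W).mpr hmult))
  · -- `d ≡ 3 (mod 4)`: `f₂ = 4`, `ord₂ Δ_min = ν + 12`; partner `d' = -d`, `t = -1`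
    have hf4 : W.conductorExponent v = 4 := hfvv'.trans
      (WeierstrassCurve.conductorExponent_eq_four_of_emod_four_eq_three v' hv' W hj' h3 hC).1
    have hord12 : W.ordMinimalDiscriminant v = ν + 12 := hordvv'.trans
      (WeierstrassCurve.kodairaSymbolAt_and_ordMinimalDiscriminant_of_emod_four_eq_three v' hv' W hj'
        hν h3 hC).2
    refine tower_two_le_of_tateForm_twist hε hC₁ W v hv v' hv' hj' hν (d := d) (d' := -d) (t := -1)
      (by omega) (Or.inl rfl) (by push_cast; ring) hC (by omega) (by omega)
  · -- `d ≡ 2 (mod 4)`: `f₂ = 6`, `ord₂ Δ_min = ν + 18`; partner `d' = ±d/2`, `t = ±2`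
    have hf6 : W.conductorExponent v = 6 := hfvv'.trans
      (WeierstrassCurve.conductorExponent_eq_six_of_emod_four_eq_two v' hv' W hj' h2 hC).1
    have hord18 : W.ordMinimalDiscriminant v = ν + 18 := hordvv'.trans
      (WeierstrassCurve.kodairaSymbolAt_and_ordMinimalDiscriminant_of_emod_four_eq_two v' hv' W hj'
        hν h2 hC).2
    obtain ⟨m, hm⟩ : ∃ m : ℤ, d = 2 * m := ⟨d / 2, by omega⟩
    have hmodd : m % 4 = 1 ∨ m % 4 = 3 := by omega
    rcases hmodd with hm1 | hm3
    · exact tower_two_le_of_tateForm_twist hε hC₁ W v hv v' hv' hj' hν (d := d) (d' := m) (t := 2)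
        hm1 (Or.inr (Or.inl rfl)) (by rw [hm]; push_cast; ring) hC (by omega) (by omega)
    · exact tower_two_le_of_tateForm_twist hε hC₁ W v hv v' hv' hj' hν (d := d) (d' := -m) (t := -2)
        (by omega) (Or.inr (Or.inr rfl)) (by rw [hm]; push_cast; ring) hC (by omega) (by omega)

end Summit.ABC.ABC.Theorems.SingleTowerSzpiroLine

end
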